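import Literature.Computability.Cryptography.CoinBlockLaws
import Literature.Computability.Complexity.CodeFPArith
import Literature.Computability.Complexity.CodeFPFinite
import Literature.Probability.Distributions.IndepProductLawDistance
import HarnessLib

/-!
# Blocks of attempts read off a coin string: the first success of each block, its law and its polynomial time

Topic `Computability/Cryptography` (family `pqc`), companion of `CoinBlockLaws.lean` (chunks of a uniform
string are independent uniform words) for the step of Micciancio–Regev's Thm. 5.23 (authors' version p. 29)
"apply `W` … let `w₁, …, w_N` be the first `N` successful outputs; if fewer succeed, fail": a machine reads
`N_w` BLOCKS of `k` attempt words of `C` coins each off its coin string, runs the (aborting) attempt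
`att : {0,1}* → Option α` on every word and keeps the first success of each block (`blocksRun`). This file
proves, generically in `att`:

* `blocksRun_eq_ofFn` — the run as an `ofFn` over the nested chunks (`CoinChunks.chunks`);
* **`map_blocksRun_eq`** — on a uniform string of length `≥ k C N_w` the blocks are INDEPENDENT, each the
  first success of `k` INDEPENDENT attempts with the attempt's law `p = (U {0,1}^C).map att`:
  `law = (⨂^{N_w} ((⨂^{k} p).map firstSome)).map ofFn` — literally the process `witnessesOf p N_w k` of
  `Algebra/EuclideanLattices/MRGapCVPBlocksD.lean` listed;
* **`blocksRun_codeFP`** — the run is typed polynomial time in `(context, (1^C, 1^k, 1^{N_w}), coins)` when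
  the attempt is typed polynomial time in `(context, word)` (`strChunks` twice, `map`, `rawFind?`).

All proved; one definition with body (`blocksRun`).

## References

* D. Micciancio, O. Regev, *Worst-case to average-case reductions based on Gaussian measures*, SIAM J. Comput.
  37 (2007) 267–302, Thm. 5.23 (proof, step (3), p. 29).
* S. Arora, B. Barak, *Computational Complexity: A Modern Approach*, CUP 2009, Def. 7.1, §7.4.1 (independent
  repetitions read off one random string) [AroraBarak2009].
-/

noncomputable section

namespace Literature.Computability.Cryptography

namespace BlockRuns

open Literature.Computability.Complexity Literature.Computability.Complexity.CodeFP
  Literature.Probability.Distributions PMF Finset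
open scoped ENNReal

variable {α : Type}

/-- **The blocks run**: block `i < N_w` is the `i`-th chunk of width `k C` of the coins; its `j`-th sub-chunk of
width `C` is the word of attempt `(i, j)`; the block's output is its first success.
[cite: MicciancioRegev2007, Thm. 5.23 (proof, step (3), p. 29)] -/
def blocksRun (att : List Bool → Option α) (C k Nw : ℕ) (r : List Bool) : List (Option α) :=
  (List.range Nw).map fun i => ((List.range k).map fun j => att (chunk C (chunk (k * C) r i) j)).findSome? id

/-- `List.ofFn` over `Fin m` as a map over `range m`. [folklore] -/
theorem ofFn_eq_map_range' {β : Type*} {m : ℕ} (f : ℕ → β) : (List.ofFn fun j : Fin m => f j) = (List.range m).map f := by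
  apply List.ext_getElem (by simp)
  intro i h₁ h₂
  simp

/-- The first success of a block as a function of its sub-chunks. [folklore] -/
def firstOf (att : List Bool → Option α) (C k : ℕ) (w : List.Vector Bool (k * C)) : Option α :=
  (List.ofFn fun j : Fin k => att (chunks C k (le_of_eq (Nat.mul_comm C k)) w j).toList).findSome? id

/-- **The run as an `ofFn` over the nested chunks.** [folklore] -/
theorem blocksRun_eq_ofFn (att : List Bool → Option α) (C k Nw : ℕ) {Ct : ℕ} (h : k * C * Nw ≤ Ct)
    (r : List.Vector Bool Ct) :
    blocksRun att C k Nw r.toList = List.ofFn fun i : Fin Nw => firstOf att C k (chunks (k * C) Nw h r i) := by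
  rw [blocksRun, ← ofFn_eq_map_range']
  congr 1
  funext i
  rw [firstOf, ← ofFn_eq_map_range' (fun j => att (chunk C (chunk (k * C) r.toList i) j))]
  rfl

/-- **The law of the blocks run on uniform coins**: independent blocks, each the first success of `k`
independent attempts with law `p = (U {0,1}^C).map att`. [cite: AroraBarak2009, Def. 7.1, §7.4.1] -/
theorem map_blocksRun_eq (att : List Bool → Option α) (C k Nw : ℕ) {Ct : ℕ} (h : k * C * Nw ≤ Ct) :
    (uniformOfFintype (List.Vector Bool Ct)).map (fun r => blocksRun att C k Nw r.toList) =
      (indepLaw Nw fun _ =>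
        (indepLaw k fun _ => (uniformOfFintype (List.Vector Bool C)).map fun w => att w.toList).map
          fun v => (List.ofFn v).findSome? id).map fun o => List.ofFn o := by
  classical
  have h1 : (fun r : List.Vector Bool Ct => blocksRun att C k Nw r.toList) =
      (fun o : Fin Nw → Option α => List.ofFn o) ∘ (fun b : Fin Nw → List.Vector Bool (k * C) => fun i => firstOf att C k (b i)) ∘
        chunks (k * C) Nw h := by
    funext r; exact blocksRun_eq_ofFn att C k Nw h r
  rw [h1, ← PMF.map_comp, ← PMF.map_comp, uniformVector_map_chunks_eq_indepLaw,
    indepLaw_map_pi Nw _ (fun _ w => firstOf att C k w)]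
  congr 1
  refine congrArg (indepLaw Nw) (funext fun _ => ?_)
  -- one block
  have h2 : (firstOf att C k : List.Vector Bool (k * C) → Option α) =
      (fun v : Fin k → Option α => (List.ofFn v).findSome? id) ∘
        (fun ws : Fin k → List.Vector Bool C => fun j => att (ws j).toList) ∘ chunks C k (le_of_eq (Nat.mul_comm C k)) := by
    funext w; rfl
  rw [h2, ← PMF.map_comp, ← PMF.map_comp, uniformVector_map_chunks_eq_indepLaw]
  congr 1
  exact indepLaw_map_pi k _ (fun _ (w : List.Vector Bool C) => att w.toList)

/-! ### Polynomial time -/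

/-- The first `some` of a raw list of option codes. [folklore] -/
theorem rawFindSome (eα : α → List Bool) : CodeFP (rawE (optE eα)) (optE eα) (fun l => l.findSome? id) := by
  have hfind := (rawFind? (σ := Unit) (eσ := fun _ => []) (eα := optE eα) (p := fun t => t.2.isSome)
    ((optIsSome eα).comp (snd _ _)) :)
  have hbind := (optBind (σ := Unit) (eσ := fun _ => []) (eα := optE eα) (eβ := eα) (g := fun t => t.2) (snd _ _) :)
  have h := (hbind.comp ((const _ ()).pair (hfind.comp ((const _ ()).pair (CodeFP.id _)))) :)
  refine h.congr fun l => ?_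
  simp only [id]
  induction l with
  | nil => rfl
  | cons o l ih =>
    rw [List.find?_cons, List.findSome?_cons]
    cases o with
    | none => exact ih
    | some a => rfl

variable {σ : Type} {eσ : σ → List Bool} {eα : α → List Bool}

/-- The code of the run's arguments: `⟨context, ⟨⟨1^C, ⟨1^k, 1^{N_w}⟩⟩, coins⟩⟩`. [folklore] -/
abbrev argE (eσ : σ → List Bool) : σ × ((ℕ × (ℕ × ℕ)) × List Bool) → List Bool :=
  pairE eσ (pairE (pairE unE (pairE unE unE)) strE)

/-- Product of unary numerals (through unit budgets). [cite: AroraBarak2009, §1.3] -/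
theorem unMul : CodeFP (pairE unE unE) unE (fun p => p.1 * p.2) :=
  ((ulength unitE).comp (unitsMul.comp ((replicateUnit.comp (fst _ _)).pair (replicateUnit.comp (snd _ _))))).congr
    fun p => by simp

/-- **The blocks run is typed polynomial time** when the attempt is, uniformly in the unary parameters.
[cite: AroraBarak2009, §1.3 (composition, bounded loops)] -/
theorem blocksRun_codeFP {att : σ → List Bool → Option α} (hatt : CodeFP (pairE eσ strE) (optE eα) (fun p => att p.1 p.2)) :
    CodeFP (argE eσ) (rawE (optE eα)) (fun p => blocksRun (att p.1) p.2.1.1 p.2.1.2.1 p.2.1.2.2 p.2.2) := by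
  have hs : CodeFP (argE eσ) eσ (fun p => p.1) := fst _ _
  have hC : CodeFP (argE eσ) unE (fun p => p.2.1.1) := (snd _ _).fst'.fst'
  have hk : CodeFP (argE eσ) unE (fun p => p.2.1.2.1) := (snd _ _).fst'.snd'.fst'
  have hN : CodeFP (argE eσ) unE (fun p => p.2.1.2.2) := (snd _ _).fst'.snd'.snd'
  have hr : CodeFP (argE eσ) strE (fun p => p.2.2) := (snd _ _).snd'
  -- the blocks: `N_w` chunks of width `k C`
  have hkC : CodeFP (argE eσ) unE (fun p => p.2.1.2.1 * p.2.1.1) := unMul.comp (hk.pair hC)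
  have hblocks : CodeFP (argE eσ) (rawE strE)
      (fun p => (List.range p.2.1.2.2).map fun i => (p.2.2.drop (i * (p.2.1.2.1 * p.2.1.1))).take (p.2.1.2.1 * p.2.1.1)) :=
    (strChunks.comp (hN.pair (hkC.pair hr)) :)
  -- one block, in the context `(s, (C, k))`: sub-chunks, attempts, first success
  have hctx : CodeFP (argE eσ) (pairE eσ (pairE unE unE)) (fun p => (p.1, (p.2.1.1, p.2.1.2.1))) := hs.pair (hC.pair hk)
  have hsub : CodeFP (pairE (pairE eσ (pairE unE unE)) strE) (rawE strE)
      (fun t => (List.range t.1.2.2).map fun j => (t.2.drop (j * t.1.2.1)).take t.1.2.1) :=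
    (strChunks.comp ((fst _ _).snd'.snd'.pair ((fst _ _).snd'.fst'.pair (snd _ _))) :)
  have hattc : CodeFP (pairE (pairE eσ (pairE unE unE)) strE) (optE eα) (fun t => att t.1.1 t.2) :=
    (hatt.comp ((fst _ _).fst'.pair (snd _ _)) :)
  have hatts : CodeFP (pairE (pairE eσ (pairE unE unE)) strE) (rawE (optE eα))
      (fun t => ((List.range t.1.2.2).map fun j => (t.2.drop (j * t.1.2.1)).take t.1.2.1).map fun w => att t.1.1 w) :=
    ((map (g := fun q : (σ × (ℕ × ℕ)) × List Bool => att q.1.1 q.2) hattc).comp ((fst _ _).pair hsub) :)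
  have hone : CodeFP (pairE (pairE eσ (pairE unE unE)) strE) (optE eα)
      (fun t => (((List.range t.1.2.2).map fun j => (t.2.drop (j * t.1.2.1)).take t.1.2.1).map fun w => att t.1.1 w).findSome? id) :=
    (rawFindSome eα).comp hatts
  have hall := ((map hone).comp (hctx.pair hblocks) :)
  refine hall.congr fun p => ?_
  obtain ⟨s, ⟨C, k, Nw⟩, r⟩ := p
  simp only [blocksRun, List.map_map]
  refine List.map_congr_left fun i _ => ?_
  simp only [Function.comp_apply]
  congr 1
  refine List.map_congr_left fun j _ => ?_
  simp only [Function.comp_apply, chunk]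
  rw [Nat.mul_comm j C, Nat.mul_comm i (k * C)]

end BlockRuns

end Literature.Computability.Cryptography

end
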